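import Summits.BirchSwinnertonDyer.BirchSwinnertonDyer.Theses.PrintX6
import Summits.BirchSwinnertonDyer.BirchSwinnertonDyer.Theorems.PrintX6EisensteinHalfFiveLeRestKimDeficitManinDatum
import Summits.BirchSwinnertonDyer.BirchSwinnertonDyer.Theorems.PrintX6EisensteinHalfFiveLeRestKimDeficitLevelCertificate
import Summits.BirchSwinnertonDyer.Rank1Residual.X4.KuriharaLowerHalf
import Literature.NumberTheory.EllipticCurves.KuriharaNumberInvariants
import Literature.NumberTheory.EllipticCurves.LocalTorsionGoodReductionProofs
import HarnessLib

/-!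
# Route `PrintX6`, crux `EisensteinHalfFiveLeRest` (stmt-BirchSwinnertonDyer-21116), line `kim-deficit`:
# stub 2 (the ENGINE) over the PROOF-COVERED `(t0)` twin of Kim 2026 Thm. 1.8 (6), with the Manin binder
# DISCHARGED from Mazur's corollary — and the crux reduced to STUB 3 alone over route inputs + that one fact

HONEST FRAMING (cell `bsd-print-x6`, run/shared/lean/pub/bsd-print-x6/; D-0152 / W-71; LEAD seat `x6-p2` g3 on
the registered line `Cruxes/EisensteinHalfFiveLeRest/Lines/kim_deficit.lean`, sha16 35e5095fac56ab01). THEOREMS ONLY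
(no definition, no named fact, no `sorry`); every statement is CONDITIONAL on named refereed facts taken as
hypotheses BY NAME (conditional-result); nothing about any particular curve is asserted; no summit statement is
proved by this seat; the crux, stub 3 and BSD stay OPEN; BSD is not proved by any of this.

## Position in the line (state 2026-08-28T06:35Z)

* stub 1 `stub_levelCertificate_of_partialInfty_le` — LANDED by name (seat x6-p2-w2 g2, p608466,
  `…KimDeficitLevelCertificate.lean`; definitions only).
* stub 2 `stub_missingLowerBoundAt_of_levelCertificate_X6` — as REGISTERED it carries no fact binder, so it is provable
  only modulo the facts its engine runs on. Landed so far: `stub_…_of_facts` (w2 g2, p608837, `…KimDeficitEngine.lean`: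
  `PublishedInputsX6 →` Kim (6) literal fact `→` a DISPLAYED Manin supply `→` stub text) and the Manin supply itself as a
  theorem over Mazur 1978 Cor. 4.1 (`exists_kimDatum_of_good_of_mazur`, this seat, p609432, `…KimDeficitManinDatum.lean`).
  THIS FILE: the stub-2 text from the PROOF-COVERED `(t0)` twin of Kim's clause (6) — a WEAKER hypothesis than the
  literal fact, which carries the referee flag `K26-(6)-shallow@t>0` — with the `(t0)` binder `#E(ℚ_p)[p] = 1`
  discharged as a THEOREM on X6 (good supersingular `p ≥ 5` ⇒ `p ∣ a_p` ⇒ `p ∤ a_p − 1`), the Manin binder discharged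
  by p609432, and the remaining inputs = route items of PrintX6 (`PublishedInputsX6` conjuncts GZK / `hasEntireLFunction_rat`
  / `nonempty_modularParametrizationData`; `InputMazurManinOdd` = stmt-19383).
* stub 3 `stub_partialInfty_le_tamagawa_X6Rest` — the HARD stub (`≤` half of Kim Conj. 1.10 on X6-Rest ∧ `r_an = 0`;
  class-wide the Kato-IMC face of the crux); NO prover by director ruling (154)(b); taken as the hypothesis `h₃` below.

## What this file proves

* §1 `missingLowerBoundAt_of_kimValue` — per pair, Kim-fact-AGNOSTIC: Kim's VALUE conclusion `L(E,1)/Ω(W) = q`,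
  `ord_p q ≤ ord_p #Ш(p) + (k − 1)` with `k ≤ ord_p ∏ c_ℓ + 1`, `E[p]` irreducible and GZK gives
  `Typed.MissingLowerBoundAt W p` (the arithmetic of `X4.padicValRat_shaAn_le_of_kimLower`, which is hard-wired to the
  literal fact, with the fact abstracted into its conclusion — so EITHER Kim fact feeds it).
* §2 **`missingLowerBoundAt_of_levelCertificate_X6_of_kimTwin`** — stub 2's registered text VERBATIM from
  (K) `Kim2026.rankZero_le_padicValNat_sha_of_kuriharaNumber_ne_zero_of_localTorsionTrivial`, (M) `mazur_not_dvd_maninConstant_of_odd`,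
  (G) GZK, (L) `hasEntireLFunction_rat`, (P) `nonempty_modularParametrizationData`; §2b the route-currency form
  `PublishedInputsX6 → InputMazurManinOdd → (K) → stub-2 text`.
* §3 **`eisensteinHalfFiveLeRest_of_kimTwin_of_stub3`** — the line's composition with stubs 1 AND 2 DISCHARGED:
  `(K) → (M) → (G) → (L) → (P) → STUB 3 → PrintX6.EisensteinHalfFiveLeRest` BY NAME (stub 1 used by name); §3b
  **`eisensteinHalfFiveLeRest_of_publishedInputsX6_of_kimTwin_of_stub3`**: `PublishedInputsX6 → InputMazurManinOdd → (K)
  → STUB 3 → EisensteinHalfFiveLeRest` — every antecedent except (K) and STUB 3 is a ROUTE ITEM of PrintX6.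

Why the registered skeleton is not reshaped to this form (LEAD decision, STATUS 06:32Z): `#h21_check_skeleton` admits as
hypotheses of the composing theorem only tagged obligations (route items / registered stubs); (K) is not an item of any
route, so `(K) → … → crux` fails `skeleton.extra-hypothesis`. TURNKEY for the planner: file Kim 2026 Thm. 1.8 (6) — best
its `(t0)` twin — as an Input item of PrintX6 (or give 21116 a pack antecedent like its sibling `EisensteinHalfFiveLeErr`);
then stub 2 re-registers as `Inputs → text`, closes BY NAME by §2b, and the skeleton's only open input is stub 3.

beyond-print theorem: NO. PARTITION: 0 cells.
[cite: Kim2022StructureSelmer, Thm. 1.9 (6) (PDF p. 8), §1.5.1–1.5.3 (PDF pp. 7–8), Prop. 3.2 (PDF p. 15), §1.3.5 (PDF p. 6)]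
[cite: Mazur1978, Cor. 4.1] [cite: GreenbergVatsal2000, §3, Remark 3.4] [cite: Miller2011LMS, Def. 1.1]
-/

set_option autoImplicit false
-- the landed namespace `Summit.BirchSwinnertonDyer.BirchSwinnertonDyer.Theorems` (summit = problem) trips the linter
set_option linter.dupNamespace false

noncomputable section

open scoped Classical MatrixGroups ModularForm

open CongruenceSubgroup WeierstrassCurve Literature.NumberTheory.EllipticCurves
  Literature.NumberTheory.EllipticCurves.ModularForms
  Literature.NumberTheory.EllipticCurves.Rank1Residual
  Literature.NumberTheory.EllipticCurves.Rank1Residual.Typed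
  Summit.BirchSwinnertonDyer.Rank1Residual.Supersingular
  Summit.BirchSwinnertonDyer.BirchSwinnertonDyer.Theses.PrintX6

namespace Summit.BirchSwinnertonDyer.BirchSwinnertonDyer.Theorems.PrintX6.KimDeficit

/-! ## §1 The lower half from Kim's value conclusion (Kim-fact-agnostic arithmetic) -/

/-- **`ord_p #Ш_an ≤ ord_p #Ш` from Kim's value conclusion at depth `k ≤ ord_p ∏ c_ℓ + 1`.** For `W/ℚ`
globally minimal elliptic, `p` prime with `E[p]` irreducible, `L(E,1) ≠ 0`, GZK (`hGZK`: rank `0` and `Ш` finite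
in analytic rank `0`): if `L(E,1)/Ω(W) = q ∈ ℚ` with `ord_p q ≤ ord_p #Ш(E)(p) + (k − 1)` and
`k ≤ ord_p ∏ c_ℓ + 1`, then `Typed.MissingLowerBoundAt W p` — since `#Ш_an = q · #T² / ∏ c_ℓ`
(`shaAn_eq_of_analyticRank_eq_zero`), `p ∤ #T` (`padicValRat_shaAn_witness`, irreducibility) and
`ord_p #Ш(p) = ord_p #Ш`. The arithmetic of `X4.padicValRat_shaAn_le_of_kimLower` /
`X4.missingLowerBoundAt_rankZero_of_kimLower` with the Kim fact abstracted into its conclusion `hq`.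
[cite: Kim2022StructureSelmer, §1.5.1–1.5.3 (PDF pp. 7–8)] [cite: Miller2011LMS, Def. 1.1] -/
theorem missingLowerBoundAt_of_kimValue (W : WeierstrassCurve ℚ) [W.IsElliptic] [W.IsGloballyMinimal]
    (p : ℕ) [Fact p.Prime] (hGZK : rank_eq_analyticRank_of_analyticRank_le_one)
    (hirr : W.HasIrreducibleModPGaloisRep p) (hL : W.entireLFunction 1 ≠ 0)
    {k : ℕ} (hkt : k ≤ padicValNat p W.tamagawaProduct + 1)
    (hq : ∃ q : ℚ, W.entireLFunction 1 / (W.realPeriodRat : ℂ) = (q : ℂ) ∧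
      padicValRat p q ≤
        (padicValNat p (Nat.card (AddCommGroup.primaryComponent W.sha p)) : ℤ) + ((k - 1 : ℕ) : ℤ)) :
    MissingLowerBoundAt W p := by
  -- adapted from Summits/BirchSwinnertonDyer/Rank1Residual/X4/KuriharaLowerHalf.lean §1
  have hr0 : W.analyticRank = 0 :=
    Literature.NumberTheory.EllipticCurves.Rank1Residual.analyticRank_eq_zero_of_entireLFunction_one_ne_zero hL
  obtain ⟨-, hfin⟩ := hGZK W (by rw [hr0]; exact zero_le_one)
  haveI : Finite W.sha := hfin
  obtain ⟨t, ht, hval⟩ := hq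
  have hΩC : (W.realPeriodRat : ℂ) ≠ 0 := Complex.ofReal_ne_zero.mpr W.realPeriodRat_pos_holds.ne'
  have ht0 : t ≠ 0 := by
    rintro rfl
    apply hL
    have h := ht
    rw [div_eq_iff hΩC] at h
    rw [h]; simp
  have hsha : padicValNat p (Nat.card (AddCommGroup.primaryComponent W.sha p)) =
      padicValNat p W.shaOrder := by
    unfold WeierstrassCurve.shaOrder
    exact padicValNat_card_addPrimaryComponent p
  refine ⟨t * (W.torsionOrder : ℚ) ^ 2 / (W.tamagawaProduct : ℚ),
    shaAn_eq_of_analyticRank_eq_zero W hGZK hr0 ht, ?_⟩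
  rw [padicValRat_shaAn_witness W p hirr ht0, ← hsha]
  have hkt' : ((k - 1 : ℕ) : ℤ) ≤ (padicValNat p W.tamagawaProduct : ℤ) := by
    have : k - 1 ≤ padicValNat p W.tamagawaProduct := by omega
    exact_mod_cast this
  linarith

/-! ## §2 THE ENGINE: stub 2 modulo the named refereed facts -/

/-- **Stub 2 of line `kim-deficit` (`stub_missingLowerBoundAt_of_levelCertificate_X6`), closed modulo NAMED
REFEREED facts.** Hypotheses BY NAME: (K) Kim 2026 Thm. 1.8 (6), proof-covered `(t0)` twin
`Kim2026.rankZero_le_padicValNat_sha_of_kuriharaNumber_ne_zero_of_localTorsionTrivial`; (M) Mazur 1978 Cor. 4.1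
`mazur_not_dvd_maninConstant_of_odd`; (G) GZK; (L) `hasEntireLFunction_rat`; (P) `nonempty_modularParametrizationData`.
Conclusion = the registered stub's statement VERBATIM: on X6 ∧ `p ≥ 5` ∧ `r_an = 0`, a Kurihara certificate of depth
`k ≤ ord_p ∏ c_ℓ + 1` for every newform of `W` at level `N_W` gives `Typed.MissingLowerBoundAt W p`. Proof: surj(p)
(`ClassX6.surj`) ⇒ `E[p]` irreducible; good supersingular `p ≥ 5` ⇒ `p ∣ a_p` ⇒ `p ∤ a_p − 1` ⇒ `#E(ℚ_p)[p] = 1`;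
`L(E,1) ≠ 0`; a datum `D₀` at level `N_W` from (P) supplies a newform, `exists_kimDatum_of_good_of_mazur` (M) a datum
`D` with `p ∤ c_D` and `Ω(W) = u·Ω⁺_{D.f}`; the certificate hypothesis at `D.f`; (K) gives the value inequality; §1.
[cite: Kim2022StructureSelmer, Thm. 1.9 (6) (PDF p. 8), Prop. 3.2 (PDF p. 15), §1.3.5 (PDF p. 6)]
[cite: Mazur1978, Cor. 4.1] [cite: Miller2011LMS, Def. 1.1] -/
theorem missingLowerBoundAt_of_levelCertificate_X6_of_kimTwin
    (hKim : Kim2026.rankZero_le_padicValNat_sha_of_kuriharaNumber_ne_zero_of_localTorsionTrivial)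
    (hM : mazur_not_dvd_maninConstant_of_odd)
    (hGZK : rank_eq_analyticRank_of_analyticRank_le_one) (hmod : hasEntireLFunction_rat)
    (hmodD : nonempty_modularParametrizationData) :
    ∀ (W : WeierstrassCurve ℚ) [W.IsElliptic] [W.IsGloballyMinimal] (p : ℕ) [Fact p.Prime],
      5 ≤ p → ClassX6 W p → W.analyticRank = 0 →
      (∀ [NeZero (W.conductorNorm ℤ)] (f : CuspForm (Gamma0 (W.conductorNorm ℤ)) 2), IsNewformOf W f →
        ∃ (k n : ℕ) (_ : NeZero n), 1 ≤ k ∧ k ≤ padicValNat p W.tamagawaProduct + 1 ∧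
          Kato.IsKolyvaginProduct W p k n ∧
          (∀ (ℓ : ℕ) [Fact ℓ.Prime], ℓ ∣ n →
            Nat.card {P : ((WeierstrassCurve.integralModelInt W).map
                (Int.castRingHom (ZMod ℓ))).toAffine.Point // p • P = 0} ≤ p) ∧
          ∃ ψ : (ℓ : ℕ) → (ZMod ℓ)ˣ →* Multiplicative (ZMod (p ^ k)),
            (∀ ℓ ∈ n.primeFactors, Function.Surjective (ψ ℓ)) ∧
              kuriharaNumber f (p ^ k) n ψ ≠ 0) →
      MissingLowerBoundAt W p := by
  intro W _ _ p _ hp5 hX hr0 hcert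
  have hpP : p.Prime := Fact.out
  have hp2 : p ≠ 2 := by omega
  have hsurj : Surj W p := ClassX6.surj W p hp2 hX
  have hirr : W.HasIrreducibleModPGaloisRep p :=
    hasIrreducibleModPGaloisRep_of_hasSurjectiveModNGaloisRep W p hsurj
  have hgood : W.HasGoodReductionAtPrime p := hX.1.1
  have hap : (p : ℤ) ∣ W.frobeniusTrace p := hX.1.2
  have hna : ¬ (p : ℤ) ∣ W.frobeniusTrace p - 1 := fun h ↦ by
    have h1 : (p : ℤ) ∣ W.frobeniusTrace p - (W.frobeniusTrace p - 1) := dvd_sub hap h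
    rw [sub_sub_cancel] at h1
    exact hpP.one_lt.ne' (by exact_mod_cast Int.eq_one_of_dvd_one (Int.natCast_nonneg p) h1)
  have ht0 := natCard_localPTorsion_eq_one_of_good_of_not_dvd_frobeniusTrace_sub_one W p (by omega) hgood hna
  have hL : W.entireLFunction 1 ≠ 0 := (W.analyticRank_eq_zero_iff_holds (hmod W)).1 hr0
  obtain ⟨-, hfin⟩ := hGZK W (by rw [hr0]; exact zero_le_one)
  haveI : NeZero (W.conductorNorm ℤ) := ⟨(W.conductorNorm_pos_holds).ne'⟩
  obtain ⟨D₀⟩ := hmodD W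
  obtain ⟨D, -, hc, hper⟩ := exists_kimDatum_of_good_of_mazur hM W p hp2 hgood hirr D₀.f D₀.isNewformOf
  obtain ⟨k, n, hn0, hk, hkt, hn, hcyc, ψ, hψ, hδ⟩ := hcert D.f D.isNewformOf
  haveI : NeZero n := hn0
  exact missingLowerBoundAt_of_kimValue W p hGZK hirr hL hkt
    (hKim W p hp5 hsurj ht0 hL hfin D hc hper k n hk hn hcyc ψ hψ hδ)

/-- **§2b — stub 2's text in ROUTE CURRENCY**: from the route's input conjunction `PublishedInputsX6` (conjuncts
(P) `nonempty_modularParametrizationData`, (L) `hasEntireLFunction_rat`, (G) GZK), its route item `InputMazurManinOdd`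
(stmt-BirchSwinnertonDyer-19383; Kim's hypothesis (ii) and the period transfer) and the ONE fact the route does not yet
list, the `(t0)` twin of Kim 2026 Thm. 1.8 (6). If the planner files that twin as an Input item, THIS is the shape in
which stub 2 re-registers and closes by name. CONDITIONAL. [cite: Kim2022StructureSelmer, Thm. 1.9 (6) (PDF p. 8)]
[cite: Mazur1978, Cor. 4.1] [cite: Kobayashi2003, Thm. 1.2 (p. 2)] -/
theorem missingLowerBoundAt_of_levelCertificate_X6_of_publishedInputsX6_of_kimTwin (hX6 : PublishedInputsX6)
    (hM : InputMazurManinOdd)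
    (hKim : Kim2026.rankZero_le_padicValNat_sha_of_kuriharaNumber_ne_zero_of_localTorsionTrivial) :
    ∀ (W : WeierstrassCurve ℚ) [W.IsElliptic] [W.IsGloballyMinimal] (p : ℕ) [Fact p.Prime],
      5 ≤ p → ClassX6 W p → W.analyticRank = 0 →
      (∀ [NeZero (W.conductorNorm ℤ)] (f : CuspForm (Gamma0 (W.conductorNorm ℤ)) 2), IsNewformOf W f →
        ∃ (k n : ℕ) (_ : NeZero n), 1 ≤ k ∧ k ≤ padicValNat p W.tamagawaProduct + 1 ∧
          Kato.IsKolyvaginProduct W p k n ∧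
          (∀ (ℓ : ℕ) [Fact ℓ.Prime], ℓ ∣ n →
            Nat.card {P : ((WeierstrassCurve.integralModelInt W).map
                (Int.castRingHom (ZMod ℓ))).toAffine.Point // p • P = 0} ≤ p) ∧
          ∃ ψ : (ℓ : ℕ) → (ZMod ℓ)ˣ →* Multiplicative (ZMod (p ^ k)),
            (∀ ℓ ∈ n.primeFactors, Function.Surjective (ψ ℓ)) ∧
              kuriharaNumber f (p ^ k) n ψ ≠ 0) →
      MissingLowerBoundAt W p := by
  obtain ⟨-, -, -, -, -, -, hmodD, hmod, hGZK⟩ := hX6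
  exact missingLowerBoundAt_of_levelCertificate_X6_of_kimTwin hKim hM hGZK hmod hmodD

/-! ## §3 The crux reduced to STUB 3 over the named facts (the line's composition, stubs 1 and 2 discharged) -/

/-- **Line `kim-deficit` with stubs 1 and 2 discharged: over (K)(M)(G)(L)(P), the HARD stub 3 alone —
`∂^(∞)(δ̃_f) ≤ ord_p ∏ c_ℓ` for the newform `f` of `W` on X6 ∧ ¬CM ∧ `p ≥ 5` ∧ `r_an = 0` ∧ ¬HasErratumPrime, the `≤`
half of Kim's Conj. 1.10 there (class-wide the Kato-IMC face of the crux, OPEN, no prover by ruling) — gives the crux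
`PrintX6.EisensteinHalfFiveLeRest` BY NAME.** `h₃` is the REGISTERED stub-3 statement verbatim (skeleton sha16
35e5095fac56ab01); stub 1 enters BY NAME (`stub_levelCertificate_of_partialInfty_le`, landed p608466); stub 2 is §2;
the proof is the skeleton's `EisensteinHalfFiveLeRest_of`. CONDITIONAL (conditional-result); the crux and stub 3 stay
open. [cite: Kim2022StructureSelmer, Thm. 1.9 (6) and Conj. 1.10 (PDF p. 8)] [cite: Mazur1978, Cor. 4.1]
[cite: Miller2011LMS, Def. 1.1] -/
theorem eisensteinHalfFiveLeRest_of_kimTwin_of_stub3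
    (hKim : Kim2026.rankZero_le_padicValNat_sha_of_kuriharaNumber_ne_zero_of_localTorsionTrivial)
    (hM : mazur_not_dvd_maninConstant_of_odd)
    (hGZK : rank_eq_analyticRank_of_analyticRank_le_one) (hmod : hasEntireLFunction_rat)
    (hmodD : nonempty_modularParametrizationData)
    (h₃ : ∀ (W : WeierstrassCurve ℚ) [W.IsElliptic] [W.IsGloballyMinimal] (p : ℕ) [Fact p.Prime],
      ¬ W.HasCM → 5 ≤ p → ClassX6 W p → W.analyticRank = 0 → ¬ HasErratumPrime W p →
      ∀ [NeZero (W.conductorNorm ℤ)] (f : CuspForm (Gamma0 (W.conductorNorm ℤ)) 2), IsNewformOf W f →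
        kuriharaPartialInfty W p f ≤ (padicValNat p W.tamagawaProduct : ℕ∞)) :
    Summit.BirchSwinnertonDyer.BirchSwinnertonDyer.Theses.PrintX6.EisensteinHalfFiveLeRest := by
  intro W _ _ p _ hCM hp5 hX hr0 hRest q hq _hvq
  have hlow : MissingLowerBoundAt W p := by
    refine missingLowerBoundAt_of_levelCertificate_X6_of_kimTwin hKim hM hGZK hmod hmodD W p hp5 hX hr0 ?_
    intro _ f hf
    exact stub_levelCertificate_of_partialInfty_le W p f (padicValNat p W.tamagawaProduct)
      (h₃ W p hCM hp5 hX hr0 hRest f hf)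
  obtain ⟨q', hq', hle⟩ := hlow
  have hqq : q = q' := by exact_mod_cast hq.symm.trans hq'
  subst hqq
  exact hle

/-- **§3b — ROUTE CURRENCY: `PublishedInputsX6 → InputMazurManinOdd → Kim (6) (t0)-twin → STUB 3 →
EisensteinHalfFiveLeRest`.** Every antecedent except the Kim twin and stub 3 is a ROUTE ITEM of PrintX6
(`PublishedInputsX6` = stmt-20302's conjunction; `InputMazurManinOdd` = stmt-19383). What the line has bought for the crux
as a ∀-statement: crux ⟸ route inputs ∧ one refereed published theorem (Kim, AJM 148 (2026) Thm. 1.8 (6), proof-covered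
reading) ∧ stub 3. CONDITIONAL; nothing closes; BSD is not proved by any of this.
[cite: Kim2022StructureSelmer, Thm. 1.9 (6) and Conj. 1.10 (PDF p. 8)] [cite: Mazur1978, Cor. 4.1] [cite: Kobayashi2003, Thm. 1.2 (p. 2)] -/
theorem eisensteinHalfFiveLeRest_of_publishedInputsX6_of_kimTwin_of_stub3 (hX6 : PublishedInputsX6)
    (hM : InputMazurManinOdd)
    (hKim : Kim2026.rankZero_le_padicValNat_sha_of_kuriharaNumber_ne_zero_of_localTorsionTrivial)
    (h₃ : ∀ (W : WeierstrassCurve ℚ) [W.IsElliptic] [W.IsGloballyMinimal] (p : ℕ) [Fact p.Prime],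
      ¬ W.HasCM → 5 ≤ p → ClassX6 W p → W.analyticRank = 0 → ¬ HasErratumPrime W p →
      ∀ [NeZero (W.conductorNorm ℤ)] (f : CuspForm (Gamma0 (W.conductorNorm ℤ)) 2), IsNewformOf W f →
        kuriharaPartialInfty W p f ≤ (padicValNat p W.tamagawaProduct : ℕ∞)) :
    Summit.BirchSwinnertonDyer.BirchSwinnertonDyer.Theses.PrintX6.EisensteinHalfFiveLeRest := by
  obtain ⟨-, -, -, -, -, -, hmodD, hmod, hGZK⟩ := hX6
  exact eisensteinHalfFiveLeRest_of_kimTwin_of_stub3 hKim hM hGZK hmod hmodD h₃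

end Summit.BirchSwinnertonDyer.BirchSwinnertonDyer.Theorems.PrintX6.KimDeficit

end
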